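import Summits.NavierStokesRegularity.FluidComputer.PalasekTowerRescaledCopyHeredity

/-!
# REGISTER v2.3′: the rescaled-copy alphabet — existence atoms versus constraint atoms of line `fc-oneshot`

Cell `ns-blowup`, seat `ns-blowup-fc-prover-3` (g0); third module of the series
`PalasekTowerRescaledCopy.lean` (p422042: vocabulary and the open statements `Capture` / `CaptureAt k` /
`Renormalise` / `FirstGateCopy` of the active line `fc-oneshot` v2.2 on the crux `EpisodeInduction`, item
stmt-NavierStokesRegularity-19178) and `PalasekTowerRescaledCopyHeredity.lean` (p422280: `Renormalise` =
designed heredity, losslessness modulo `Capture`, propagation). LABEL: E–C typing (KERNEL bookkeeping;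
every implication proved; open statements only as hypotheses or inside equivalences). WHAT THIS IS NOT:
not Navier–Stokes evidence — no stage, letter, tower or instance is constructed or asserted; nothing
here proves or refutes a stub of the line.

## Why

A statement about registered stages is either an EXISTENCE atom («some continuation / extension
exists» — not refutable by exhibiting a flow) or a CONSTRAINT atom («every registered flow has property
P» — refutable by ONE exhibited registered stage, and the only kind a MODEL computation can shadow). The
line's two stubs mix the kinds: `Capture` is a constraint, `Renormalise` is existence (a continuation)
AND constraint (its readout is again a copy). This module separates them, unconditionally:

* §0 (sanity, the v1 failure mode in the kernel) the copy relation never clashes with the ENVELOPE of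
  consecutive levels: any parent field with the level-`j` floor somewhere in the ball and the level-`j`
  ceiling everywhere has, about any centre of the ball, an exact (`0`-tolerance) rescaled copy with the
  level-`k` floor and the level-`k` ceiling (`RescaledCopy.exists_copy_within_envelope`) — unlike the
  withdrawn v1 cut, whose `Transfer` contradicted the ceiling on every stage;
* §1 two atoms by name — `CopyPropagates` (CONSTRAINT, levels `k ≥ 2`: in every registered stage at
  level `k + 1` whose letters of levels `k - 1, k` are `2/3`-copies, the letters of levels `k, k + 1` are
  `2/3`-copies — «self-similarity, once seeded, persists along every registered flow») and
  `HeredityFromTwoOnCopies` (EXISTENCE, levels `k ≥ 2`: every registered stage IN the copy design extends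
  to a registered stage — the child crux `HeredityFrom 2` restricted to designed stages);
* §2 `Renormalise ↔ HeredityFromTwoOnCopies ∧ CopyPropagates` (`renormalise_iff_onCopies_and_propagates`;
  ⇒ uses silent-window uniqueness `Stage.continuation_velocity_eq`, Tao 2013 Cor. 11.4 unforced + Lemma
  8.1, tree theorems; ⇐ is bookkeeping);
* §3 `Capture ↔ CaptureAt 2 ∧ CopyPropagates` (`capture_iff_captureAt_two_and_propagates`; induction on
  the level through `Stage.restrictOfAntitone`; NO uniqueness, NO gate) — sharpening p422280's
  `capture_iff_captureAt_two`, which needed the gate stub;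
* §4 the four-atom form of the crux with alphabet closure:
  `EpisodeInductionG ∧ Capture ↔ HeredityAtOne ∧ CaptureAt 2 ∧ HeredityFromTwoOnCopies ∧ CopyPropagates`
  — two existence atoms (`HeredityAtOne` = item -19249; `HeredityFromTwoOnCopies` ⇐ item -19250) and two
  constraint atoms (`CaptureAt 2`, `CopyPropagates`: the killable content of the line, the NS-side form of
  what the MODEL falsifier COPY-FIT-1 shadows).

References: T. Tao, J. Amer. Math. Soc. 29 (2016), §1.3 [cite: Tao2016AveragedNS, §1.3]; T. Tao, Anal.
PDE 6 (2013), Cor. 11.4, Lemma 8.1 [cite: Tao2011, Cor. 11.4]; S. Palasek, arXiv:2605.13827 §4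
[cite: Palasek2026ElementaryModel, §4].
-/

noncomputable section

namespace Summit.NavierStokesRegularity.FluidComputer.PalasekTowerClayBridge

open Set MeasureTheory Filter Topology Function Real
open scoped ENNReal ContDiff NNReal
open Literature.Analysis.FluidPDE

/-! ## §0 Sanity: the copy relation is compatible with the envelope of consecutive levels -/

namespace RescaledCopy

variable {S : Schedule TowerRates.wide} {j k : ℕ}
  {w : EuclideanSpace ℝ (Fin 3) → EuclideanSpace ℝ (Fin 3)}

/-- The exact zoom of a field under the parent ceiling `C·Y_j` obeys the child ceiling `C·Y_k`.
[folklore] -/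
theorem norm_zoom_le (Q : EuclideanSpace ℝ (Fin 3) ≃ₗᵢ[ℝ] EuclideanSpace ℝ (Fin 3))
    (x₀ x₁ : EuclideanSpace ℝ (Fin 3)) {C : ℝ} (hw : ∀ y, ‖w y‖ ≤ C * TowerRates.wide.Y j)
    (y : EuclideanSpace ℝ (Fin 3)) :
    ‖(TowerRates.wide.Y k / TowerRates.wide.Y j) •
        Q (w (x₀ + (TowerRates.wide.N k / TowerRates.wide.N j) • Q.symm (y - x₁)))‖ ≤
      C * TowerRates.wide.Y k := by
  have hYk : 0 < TowerRates.wide.Y k := Real.rpow_pos_of_pos (TowerRates.wide.N_pos _) _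
  have hYj : 0 < TowerRates.wide.Y j := Real.rpow_pos_of_pos (TowerRates.wide.N_pos _) _
  rw [norm_smul, LinearIsometryEquiv.norm_map, Real.norm_of_nonneg (div_pos hYk hYj).le]
  calc TowerRates.wide.Y k / TowerRates.wide.Y j * ‖w _‖
      ≤ TowerRates.wide.Y k / TowerRates.wide.Y j * (C * TowerRates.wide.Y j) :=
        mul_le_mul_of_nonneg_left (hw _) (div_pos hYk hYj).le
    _ = C * TowerRates.wide.Y k := by
        rw [mul_left_comm, div_mul_cancel₀ _ hYj.ne']

/-- **The copy relation is compatible with the floors-and-ceilings envelope** (the v1 failure mode,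
checked in the kernel for v2): a parent field with the level-`j` floor `c₁ Y_j` at some point of the
ball and the level-`j` ceiling `c₂ Y_j` everywhere has, re-centred at ANY point `x₁` of the ball, an
exact rescaled copy (tolerance `0`, hence every tolerance `δ ≥ 0`) that carries the level-`k` floor at
`x₁` and obeys the level-`k` ceiling everywhere. Pure kinematics of the relation; no flow. [folklore] -/
theorem exists_copy_within_envelope (hfl : ∃ x₀, ‖x₀‖ ≤ S.radius ∧ S.c₁ * TowerRates.wide.Y j ≤ ‖w x₀‖)
    (hceil : ∀ y, ‖w y‖ ≤ S.c₂ * TowerRates.wide.Y j) {x₁ : EuclideanSpace ℝ (Fin 3)}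
    (h₁ : ‖x₁‖ ≤ S.radius) {δ : ℝ} (hδ : 0 ≤ δ) :
    ∃ v : EuclideanSpace ℝ (Fin 3) → EuclideanSpace ℝ (Fin 3),
      RescaledCopy S j k w v δ ∧ S.c₁ * TowerRates.wide.Y k ≤ ‖v x₁‖ ∧
        ∀ y, ‖v y‖ ≤ S.c₂ * TowerRates.wide.Y k := by
  obtain ⟨x₀, h₀, hfl⟩ := hfl
  let Q : EuclideanSpace ℝ (Fin 3) ≃ₗᵢ[ℝ] EuclideanSpace ℝ (Fin 3) := LinearIsometryEquiv.refl ℝ _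
  have hcopy := of_zoom (S := S) (k := k) Q h₀ h₁ hfl
  refine ⟨_, hcopy.mono hδ, ?_, fun y => norm_zoom_le Q x₀ x₁ hceil y⟩
  -- the anchor clause is hidden behind the `∃` of `RescaledCopy`; re-derive it at `x₁` directly
  have hYk : 0 < TowerRates.wide.Y k := Real.rpow_pos_of_pos (TowerRates.wide.N_pos _) _
  have hYj : 0 < TowerRates.wide.Y j := Real.rpow_pos_of_pos (TowerRates.wide.N_pos _) _
  simp only [sub_self, map_zero, smul_zero, add_zero, norm_smul, LinearIsometryEquiv.norm_map]
  rw [Real.norm_of_nonneg (div_pos hYk hYj).le]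
  calc S.c₁ * TowerRates.wide.Y k
      = TowerRates.wide.Y k / TowerRates.wide.Y j * (S.c₁ * TowerRates.wide.Y j) := by
        rw [mul_left_comm, div_mul_cancel₀ _ hYj.ne']
    _ ≤ TowerRates.wide.Y k / TowerRates.wide.Y j * ‖w x₀‖ :=
        mul_le_mul_of_nonneg_left hfl (div_pos hYk hYj).le

end RescaledCopy

/-! ## §1 The two atoms -/

/-- **COPIES PROPAGATE** (CONSTRAINT atom, OPEN, never asserted): for every pinned (`Λ = 8`, `θ = 6/5`),
rigid, quiet schedule on the wide-base rates, every `k ≥ 2` and every globally anchored registered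
stage at level `k + 1`: if its level-`k` letter is a `2/3`-rescaled copy of its level-`(k-1)` letter,
then its level-`(k+1)` letter is a `2/3`-rescaled copy of its level-`k` letter. A property of registered
FLOWS (no continuation is asked to exist); refutable by one exhibited stage. [cite: Tao2016AveragedNS, §1.3] -/
@[conjecture] def CopyPropagates : Prop :=
  ∀ S : Schedule TowerRates.wide, S.Pins 8 (6 / 5) → S.Rigid → S.Quiet → ∀ k : ℕ, 2 ≤ k →
    ∀ s : Stage 1 TowerRates.wide S (Margins.routeG TowerRates.wide) (k + 1),
      RescaledCopy S (k - 1) k (s.u (S.τ (k - 1))) (s.u (S.τ k)) (2 / 3) →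
      RescaledCopy S k (k + 1) (s.u (S.τ k)) (s.u (S.τ (k + 1))) (2 / 3)

/-- **HEREDITY FROM LEVEL `2` ON COPY STAGES** (EXISTENCE atom, OPEN, never asserted): every globally
anchored registered stage at level `k ≥ 2` whose level-`k` letter is a `2/3`-copy of its level-`(k-1)`
letter extends to a registered stage at level `k + 1` — the child crux `HeredityFrom 2`
(item -19250) restricted to stages IN the copy design. [cite: Palasek2026ElementaryModel, §4] -/
@[conjecture] def HeredityFromTwoOnCopies : Prop :=
  ∀ S : Schedule TowerRates.wide, S.Pins 8 (6 / 5) → S.Rigid → S.Quiet → ∀ k : ℕ, 2 ≤ k →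
    ∀ s : Stage 1 TowerRates.wide S (Margins.routeG TowerRates.wide) k,
      RescaledCopy S (k - 1) k (s.u (S.τ (k - 1))) (s.u (S.τ k)) (2 / 3) →
      ∃ s' : Stage 1 TowerRates.wide S (Margins.routeG TowerRates.wide) (k + 1), s.Extends s'

/-- The child crux contains its restriction to copy stages. [folklore] -/
theorem HeredityFrom.onCopies (h : HeredityFrom 2) : HeredityFromTwoOnCopies :=
  fun S hP hR hQ k hk s _ => h S hP hR hQ k hk s

/-- Given alphabet closure the restriction is no restriction: `Capture → HeredityFromTwoOnCopies →
HeredityFrom 2`. [folklore] -/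
theorem HeredityFromTwoOnCopies.heredityFrom_two (h : HeredityFromTwoOnCopies) (hC : Capture) :
    HeredityFrom 2 :=
  fun S hP hR hQ k hk s => h S hP hR hQ k hk s (hC S hP hR hQ k hk s)

/-- Alphabet closure contains the propagation constraint (its conclusion holds for every stage).
[folklore] -/
theorem Capture.copyPropagates (hC : Capture) : CopyPropagates := by
  intro S hP hR hQ k hk s _
  have hc := hC S hP hR hQ (k + 1) (le_trans hk (Nat.le_succ k)) s
  rw [Nat.add_sub_cancel] at hc
  exact hc

/-! ## §2 The gate stub is the existence atom together with the propagation constraint -/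

/-- The gate stub contains heredity on copy stages (drop the output copy). [folklore] -/
theorem Renormalise.onCopies (hR : Renormalise) : HeredityFromTwoOnCopies := by
  intro S hP hRig hQ k hk s hc
  obtain ⟨u, p, hrun, hlet, -⟩ := hR S hP hRig hQ k hk s hc
  exact s.exists_extends_iff_runs_letter.2 ⟨u, p, hrun, hlet⟩

/-- **The gate stub contains the propagation constraint**: a registered stage `s` at level `k + 1` whose
letters `(k-1, k)` are copies restricts to a level-`k` stage in the copy design; the gate returns a
finite-energy classical continuation with a copy readout, which coincides with `s.u` on `[0, τ (k+1)]`
by silent-window uniqueness (quiet schedule, `k ≥ 2`; `Stage.continuation_velocity_eq`, no named fact).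
[cite: Tao2011, Cor. 11.4] -/
theorem Renormalise.copyPropagates (hR : Renormalise) : CopyPropagates := by
  intro S hP hRig hQ k hk s hc
  let s₀ : Stage 1 TowerRates.wide S (Margins.routeG TowerRates.wide) k :=
    s.restrictOfAntitone (Margins.antitone_routeG TowerRates.wide) (Nat.le_succ k)
  obtain ⟨u, p, ⟨hcl, hagree, henergy, -⟩, -, hcopy⟩ := hR S hP hRig hQ k hk s₀ hc
  have heq : ∀ t ∈ Icc 0 (S.τ (k + 1)), u t = s.u t :=
    s₀.continuation_velocity_eq one_pos hQ hk (S.τ_mono (Nat.le_succ k)) hcl s.classical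
      (fun t ht => (hagree t ht).1) (fun _ _ => rfl) henergy s.energy
  rw [← heq (S.τ (k + 1)) ⟨(S.τ_pos _).le, le_rfl⟩]
  exact hcopy

/-- Conversely the two atoms give the gate stub: extend the copy stage (existence atom), and read the
output copy off the extension by the propagation constraint (its input copy clause is the stage's, by
the agreement at `τ (k-1)`, `τ k`). [folklore] -/
theorem renormalise_of_onCopies_propagates (hH : HeredityFromTwoOnCopies) (hP : CopyPropagates) :
    Renormalise := by
  intro S hPin hR hQ k hk s hc
  obtain ⟨s', hs'⟩ := hH S hPin hR hQ k hk s hc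
  refine ⟨s'.u, s'.p, Runs.of_extends s s' hs', Letter.of_stage s' le_rfl, ?_⟩
  have hk1 : S.τ (k - 1) ∈ Icc 0 (S.τ k) := ⟨(S.τ_pos _).le, S.τ_mono (Nat.sub_le k 1)⟩
  have hc' : RescaledCopy S (k - 1) k (s'.u (S.τ (k - 1))) (s'.u (S.τ k)) (2 / 3) := by
    rw [(hs' _ hk1).1, (hs' (S.τ k) ⟨(S.τ_pos k).le, le_rfl⟩).1]
    exact hc
  have hout := hP S hPin hR hQ k hk s' hc'
  rw [(hs' (S.τ k) ⟨(S.τ_pos k).le, le_rfl⟩).1] at hout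
  exact hout

/-- **The gate stub, decomposed**: `Renormalise ↔ HeredityFromTwoOnCopies ∧ CopyPropagates` — one
existence atom (continuations of copy stages exist and are registered) and one constraint atom (copies
propagate along every registered flow). [cite: Tao2011, Cor. 11.4] -/
theorem renormalise_iff_onCopies_and_propagates :
    Renormalise ↔ HeredityFromTwoOnCopies ∧ CopyPropagates :=
  ⟨fun h => ⟨h.onCopies, h.copyPropagates⟩, fun h => renormalise_of_onCopies_propagates h.1 h.2⟩

/-! ## §3 Alphabet closure is its first instance together with the propagation constraint -/

/-- One level of induction WITHOUT the gate: `CopyPropagates → CaptureAt k → CaptureAt (k + 1)` for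
`k ≥ 2` (restrict the level-`(k+1)` stage to level `k`, read its input copy clause off `CaptureAt k`,
propagate). No uniqueness and no continuation is involved. [folklore] -/
theorem CaptureAt.succ_of_propagates {k : ℕ} (h : CaptureAt k) (hP : CopyPropagates) (hk : 2 ≤ k) :
    CaptureAt (k + 1) := by
  intro S hPin hR hQ s
  have hc := h S hPin hR hQ (s.restrictOfAntitone (Margins.antitone_routeG TowerRates.wide) (Nat.le_succ k))
  rw [Nat.add_sub_cancel]
  exact hP S hPin hR hQ k hk s hc

/-- Through a range of levels: `CopyPropagates → CaptureAt k₀ → CaptureAt k` for `2 ≤ k₀ ≤ k`.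
[folklore] -/
theorem CaptureAt.of_le_of_propagates {k₀ k : ℕ} (h : CaptureAt k₀) (hP : CopyPropagates)
    (hk₀ : 2 ≤ k₀) (hk : k₀ ≤ k) : CaptureAt k := by
  induction k, hk using Nat.le_induction with
  | base => exact h
  | succ k hle ih => exact ih.succ_of_propagates hP (hk₀.trans hle)

/-- **Alphabet closure, decomposed — unconditionally**: `Capture ↔ CaptureAt 2 ∧ CopyPropagates` (the
seed at the first generic level, and persistence along every registered flow). [folklore] -/
theorem capture_iff_captureAt_two_and_propagates : Capture ↔ CaptureAt 2 ∧ CopyPropagates :=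
  ⟨fun h => ⟨h.captureAt le_rfl, h.copyPropagates⟩,
    fun h => capture_iff_forall_captureAt.2 fun _ hk => h.1.of_le_of_propagates h.2 le_rfl hk⟩

/-! ## §4 The four atoms of the crux with alphabet closure -/

/-- **`EpisodeInductionG ∧ Capture` in atoms**: the first gate (`HeredityAtOne`, item -19249; existence,
`k = 1`), the seed (`CaptureAt 2`; constraint, `k = 2`), heredity on copy stages (existence, `k ≥ 2`;
implied by item -19250) and persistence (`CopyPropagates`; constraint, `k ≥ 2`) — unconditionally
equivalent. The line `fc-oneshot` asserts the four through {`stub_heredityAtOne`, `stub_capture` =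
seed ∧ persistence, `stub_renormalise` = heredity-on-copies ∧ persistence}. [folklore] -/
theorem episodeInductionG_and_capture_iff_atoms :
    EpisodeInductionG ∧ Capture ↔
      HeredityAtOne ∧ CaptureAt 2 ∧ HeredityFromTwoOnCopies ∧ CopyPropagates := by
  constructor
  · rintro ⟨hE, hC⟩
    exact ⟨hE.heredityAtOne, hC.captureAt le_rfl, (hE.heredityFrom (by norm_num)).onCopies,
      hC.copyPropagates⟩
  · rintro ⟨h₁, h₂, hH, hP⟩
    have hC : Capture := capture_iff_captureAt_two_and_propagates.2 ⟨h₂, hP⟩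
    exact ⟨episodeInductionG_iff_heredityAtOne_and_heredityFrom_two.2 ⟨h₁, hH.heredityFrom_two hC⟩, hC⟩

/-- The same split read on the line's stub set: {first gate, seed, gate stub} already give the crux with
alphabet closure (the gate stub supplies persistence). [folklore] -/
theorem episodeInductionG_and_capture_of_stubs (h₁ : HeredityAtOne) (h₂ : CaptureAt 2)
    (hR : Renormalise) : EpisodeInductionG ∧ Capture :=
  episodeInductionG_and_capture_iff_atoms.2 ⟨h₁, h₂, hR.onCopies, hR.copyPropagates⟩

end Summit.NavierStokesRegularity.FluidComputer.PalasekTowerClayBridge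

end
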